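import Literature.NumberTheory.Automorphic.Liu2021.Thm418AsPrinted
import HarnessLib

/-!
# [Liu 2021] Proposition 4.13 AS PRINTED — `H¹_{B,τ'}(A_∞, ℂ) ≃ ⊕_{(μ,ε,χ)} ω(μ, ε, χ)` as `ℂ[𝔾(𝔸_F^∞)]`-modules

Y. Liu, *Fourier–Jacobi cycles and arithmetic relative trace formula*, Camb. J. Math. **9** (2021) 1–147 = arXiv:2102.11518
[Liu2021]; TeX source `FJcycle.tex` (md5 `6db49a74122d…`), §4.2 «Albanese of unitary Shimura varieties», Proposition 4.13 =
TeX label `pr:endoscopy_general`, ll. 2113–2119.  Companion of `Thm418AsPrinted` (same discipline, same carriers where they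
coincide): typed because the cells' closing paths consume Prop. 4.13 either as PLACEMENT (the package reading `Thm418C` of
Thm. 4.18, via the proof map (4.3)) or as EXHAUSTION (`hD`), and the tree so far carries Prop. 4.13 only as a multiplicity COUNT
over bare carriers (`Literature.AlgebraicGeometry.Liu2021.LiuAlbaneseDatum.Prop413`); this file is the MODULE-ISOMORPHISM
sentence, statement-exact (pub-hodgecm2 lead, HOME/INBOX l. 4971 (2) (I-c); b01-idea-1 IDEA-1w §1).

AS PRINTED, VERBATIM.  Standing data of §4.2 (ll. 2053–2074, quoted in `Thm418AsPrinted`): «Let `n ≥ 2` be an integer. Let `𝕍`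
be a totally definite incoherent hermitian space over `𝔸_E` of rank `n` […] `𝔾 := U(𝕍)` […] `X_K := \tilde Sh(𝕍)_K` […] We
denote by `A_K` the Albanese variety `Alb_{X_K}` of `X_K` […] `A_∞ := lim_K A_K` […] the Hecke correspondences provide a
homomorphism `𝔾(𝔸_F^∞) → Aut_E(A_∞)`.»  Then (ll. 2077–2081): «To study isogeny factors of `A_K`, it suffices to study the
`L`-function of `H¹_{ét}((A_K)_{E^{ac}}, ℚ_ℓ^{ac})` by Faltings' isogeny theorem. We start from describing its Betti cohomology
`H¹_{B,τ'}(A_K, ℂ)`. For every embedding `τ' : E → ℂ`, put `H¹_{B,τ'}(A_∞, ℂ) := colim_K H¹_{B,τ'}(A_K, ℂ)`, which is an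
admissible representation of `𝔾(𝔸_F^∞)`.»  **Def. 4.11** (ll. 2083–2097): «An *adèlic oscillator triple* is a triple `(μ, ε, χ)`
consisting of • a conjugate symplectic automorphic character (Definition 4.1) `μ = ⊗ μ_v : E^× \ 𝔸_E^× → ℂ^×` (whose value is
necessarily in `ℂ^1`), • a collection `ε = (ε_v ∈ E_v^{−×} / Nm_{E_v/F_v} E_v^×)_v` for every nonarchimedean place `v` of `F`
such that `ε_v ∈ O_{E_v}^× Nm_{E_v/F_v} E_v^×` for all but finitely many `v`, and • an automorphic character
`χ = ⊗ χ_v : E^1 \ (𝔸_E^∞)^1 → ℂ^×` (whose value is necessarily in `ℂ^1`).  For an adèlic oscillator triple `(μ, ε, χ)`, […]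
`ω(μ, ε, χ) := ⊗'_v ω(μ_v, ε_v, χ_v)`, which is an irreducible admissible representation of `𝔾(𝔸_F^∞)`.»  **Def. 4.12**
(ll. 2102–2110): «In an adèlic oscillator triple `(μ, ε, χ)`, we say that `ε` is *`μ`-admissible* if there exists some
`e ∈ E^{×−}` such that • `ε_v = e Nm_{E_v/F_v} E_v^×` for every nonarchimedean place `v` of `F`, and • `τ'(e)` has negative
imaginary part for every `τ' ∈ Φ_μ`.»

**PROPOSITION 4.13** (ll. 2113–2119), VERBATIM: «Suppose that `n ≥ 3`. Then for every embedding `τ' : E → ℂ`, there is an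
isomorphism
    `H¹_{B,τ'}(A_∞, ℂ) ≃ ⊕_{(μ,ε,χ)} ω(μ, ε, χ)`
of `ℂ[𝔾(𝔸_F^∞)]`-modules, where the direct sum is taken over all adèlic oscillator triples in which `μ` is of weight one and
`ε` is `μ`-admissible.»

## The typing (paper order; ⟨CARRIER⟩ = posited datum standing for a printed object Lean cannot construct, as in `Thm418Data`)

* `F`, `E` as in `Thm418Data` (l. 1878: `F` totally real, `E/F` totally imaginary quadratic — instance arguments; `E` is then
  a CM field, `isCMField F E`, READING R1 of `Thm418AsPrinted`).
* `n`, `2 ≤ n` (l. 2053) — the standing hypothesis; «Suppose that `n ≥ 3`» is the HYPOTHESIS of the proposition and is typed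
  as the antecedent `3 ≤ n →` of `Prop413AsPrinted` (not as a field).
* ⟨CARRIER⟩ `𝕍`, `G = 𝔾(𝔸_F^∞)` (a topological group), `Eps`, `epsOf`, `Chi` — VERBATIM the carriers of `Thm418Data` (Def. C.3,
  l. 2060, Def. 4.11 second and third bullets, Def. 4.12 first bullet); they do not depend on `μ`.
* ⟨CARRIER⟩ `omega μ hμ ε χ` with `rho μ hμ ε χ : Representation ℂ G (omega μ hμ ε χ)` — the `ℂ[𝔾(𝔸_F^∞)]`-module
  `ω(μ, ε, χ)` of Def. 4.11 for EVERY adèlic oscillator triple, i.e. for every REAL conjugate symplectic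
  `μ : IdeleClassGroup E →ₜ* Circle` (`hμ : IsConjugateSymplectic E μ`, Def. 4.1) and all `ε`, `χ` (whereas `Thm418Data.omega`
  is the sub-family at its one fixed `μ`; a consumer holding both data for the same `𝕍` identifies `D.omega ε χ` with
  `P.omega D.μ D.isConjugateSymplectic ε χ` — their bookkeeping, not asserted here).
* ⟨CARRIER⟩ `HB τ'` with `rhoB τ' : Representation ℂ G (HB τ')`, for every embedding `τ' : E →+* ℂ` — «`H¹_{B,τ'}(A_∞, ℂ) :=
  colim_K H¹_{B,τ'}(A_K, ℂ)`, which is an admissible representation of `𝔾(𝔸_F^∞)`» (ll. 2077–2081); the cells instantiate it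
  with their constructed tower colimit of `H¹(P_Γ(V); ℂ)` (the «pin's `H`»).
* The index of the direct sum — «all adèlic oscillator triples in which `μ` is of weight one and `ε` is `μ`-admissible» — is
  REAL on `μ`: `Prop413Data.Triple` = `(μ, hμ, ε, χ)`, `Triple.HasWeightOne` = `IdeleClassGroup.HasWeight E μ 1` (Def. 4.3 (1)),
  `Triple.IsAdmissible` = Def. 4.12 through the tree's `IsAdmissibleElement E Φ_μ e` with `Φ_μ = hμ.cmType` (Def. 4.3 (2)) and the
  carrier `epsOf` — token for token `Thm418Data.IsAdmissible`; `AdmTriple` the subtype.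
* «isomorphism … of `ℂ[𝔾(𝔸_F^∞)]`-modules» = a `ℂ`-linear equivalence `HB τ' ≃ₗ[ℂ] ⨁_t ω_t` intertwining `rhoB τ' g` with the
  componentwise `rho … g` (READING R6 of `Thm418AsPrinted`); «there is an isomorphism» = `∃ Φ`.
No hypothesis is added or dropped: in particular no condition on `τ'` (EVERY embedding), none on `[F:ℚ]`, no Galois / signature
/ compactness condition (Noncompact and Compact Case alike, l. 2054–2058), and `n ≥ 3` exactly as printed (the case `n = 2` is
Prop. D.4 / Rem. D.5, not typed).  A consumer takes `(h : Prop413AsPrinted P)` for ITS OWN `P`.  NO PROOF (Track 2).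
NOT here: Remark 4.14, Lemma 4.15 (Lemma `le:albanese`), the proof (Matsushima, Zucker, [MR92]).

## References
* [Liu2021] Y. Liu, Camb. J. Math. 9 (2021) 1–147 = arXiv:2102.11518 — §4.2 ll. 2053–2081, Def. 4.11 (ll. 2083–2097), Def. 4.12
  (ll. 2102–2110), Prop. 4.13 (ll. 2113–2119).
-/

noncomputable section

open NumberField DirectSum
open Literature.AlgebraicGeometry.Motives (CMType)
open Literature.AlgebraicGeometry.Liu2021 (IsAdmissibleElement)

namespace Literature.NumberTheory.Automorphic.Liu2021

/-- **The data of [Liu2021, Prop. 4.13]**, in paper order, over the number fields `F ⊆ E` of l. 1878 (`F` totally real, `E/F`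
totally imaginary quadratic, as instance arguments).  Fields marked ⟨CARRIER⟩ are posited data standing for printed objects Lean
cannot construct (`Thm418AsPrinted`, module docstring «What a CARRIER is»); the family `omega` is indexed by the REAL conjugate
symplectic characters `μ` of `E`.  Nothing is asserted by this structure.
[cite: Liu2021, §4.2 (ll. 2053–2081), Def. 4.11, Def. 4.12, Prop. 4.13] -/
structure Prop413Data (F E : Type) [Field F] [NumberField F] [IsTotallyReal F] [Field E] [NumberField E]
    [Algebra F E] [IsTotallyComplex E] [Algebra.IsQuadraticExtension F E] : Type 1 where
  /-- «Let `n ≥ 2` be an integer» (l. 2053): the rank of `𝕍`. -/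
  n : ℕ
  /-- «`n ≥ 2`» (l. 2053), the standing hypothesis of §4.2 («`n ≥ 3`» is the hypothesis OF Prop. 4.13, see `Prop413AsPrinted`). -/
  two_le_n : 2 ≤ n
  /-- ⟨CARRIER⟩ (token) `𝕍`, «a totally definite incoherent hermitian space over `𝔸_E` of rank `n` (Definition C.3)» (l. 2053),
  as in `Thm418Data.𝕍`. -/
  𝕍 : Type
  /-- ⟨CARRIER⟩ `G = 𝔾(𝔸_F^∞)`, `𝔾 := U(𝕍)` «the unitary group of `𝕍`, which is a reductive group over `𝔸_F`» (l. 2060), its group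
  of finite-adèlic points as a topological group, as in `Thm418Data.G`. -/
  G : Type
  [instGroup : Group G]
  [instTopologicalSpace : TopologicalSpace G]
  [instIsTopologicalGroup : IsTopologicalGroup G]
  /-- ⟨CARRIER⟩ the collections `ε = (ε_v ∈ E_v^{−×} / Nm_{E_v/F_v} E_v^×)_v` «such that `ε_v ∈ O_{E_v}^× Nm_{E_v/F_v} E_v^×` for all
  but finitely many `v`» (Def. 4.11, second bullet, l. 2088), as in `Thm418Data.Eps`. -/
  Eps : Type
  /-- ⟨CARRIER⟩ `e ↦ (e · Nm_{E_v/F_v} E_v^×)_v` (Def. 4.12, first bullet, l. 2105), as in `Thm418Data.epsOf`. -/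
  epsOf : E → Eps
  /-- ⟨CARRIER⟩ the automorphic characters «`χ = ⊗ χ_v : E^1 \ (𝔸_E^∞)^1 → ℂ^×`» (Def. 4.11, third bullet, l. 2090), as in
  `Thm418Data.Chi`. -/
  Chi : Type
  /-- ⟨CARRIER⟩ the underlying `ℂ`-vector space of «the adèlic oscillator representation attached to `(μ, ε, χ)`,
  `ω(μ, ε, χ) := ⊗'_v ω(μ_v, ε_v, χ_v)`, which is an irreducible admissible representation of `𝔾(𝔸_F^∞)`» (Def. 4.11, l. 2092–2096),
  for EVERY adèlic oscillator triple: `μ` a REAL conjugate symplectic character of `C_E` (Def. 4.11 first bullet with Def. 4.1: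
  `IdeleClassGroup.IsConjugateSymplectic E μ`, over `E⁺ ≃ F`, READING R1), `ε : Eps`, `χ : Chi`. -/
  omega : ∀ μ : IdeleClassGroup E →ₜ* Circle,
    (letI : IsCMField E := isCMField F E; IdeleClassGroup.IsConjugateSymplectic E μ) → Eps → Chi → Type
  [instAddCommGroupOmega : ∀ μ hμ ε χ, AddCommGroup (omega μ hμ ε χ)]
  [instModuleOmega : ∀ μ hμ ε χ, Module ℂ (omega μ hμ ε χ)]
  /-- ⟨CARRIER⟩ the action of `𝔾(𝔸_F^∞)` on `ω(μ, ε, χ)` (Def. 4.11). -/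
  rho : ∀ μ hμ ε χ, Representation ℂ G (omega μ hμ ε χ)
  /-- ⟨CARRIER⟩ the `ℂ`-vector space «`H¹_{B,τ'}(A_∞, ℂ) := colim_K H¹_{B,τ'}(A_K, ℂ)`» (l. 2079) for an embedding `τ' : E → ℂ`
  (`A_K = Alb_{X_K}`, `X_K = \tilde Sh(𝕍)_K`, ll. 2062–2074; Betti cohomology of the complex manifold `A_K ⊗_{E,τ'} ℂ`). -/
  HB : (E →+* ℂ) → Type
  [instAddCommGroupHB : ∀ τ', AddCommGroup (HB τ')]
  [instModuleHB : ∀ τ', Module ℂ (HB τ')]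
  /-- ⟨CARRIER⟩ the action making `H¹_{B,τ'}(A_∞, ℂ)` «an admissible representation of `𝔾(𝔸_F^∞)`» (l. 2081): induced by «the
  Hecke correspondences … `𝔾(𝔸_F^∞) → Aut_E(A_∞)`» (l. 2074). -/
  rhoB : ∀ τ', Representation ℂ G (HB τ')

attribute [instance] Prop413Data.instGroup Prop413Data.instTopologicalSpace Prop413Data.instIsTopologicalGroup
  Prop413Data.instAddCommGroupOmega Prop413Data.instModuleOmega Prop413Data.instAddCommGroupHB Prop413Data.instModuleHB

namespace Prop413Data

variable {F E : Type} [Field F] [NumberField F] [IsTotallyReal F] [Field E] [NumberField E] [Algebra F E]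
  [IsTotallyComplex E] [Algebra.IsQuadraticExtension F E] (P : Prop413Data F E)

/-- **An adèlic oscillator triple `(μ, ε, χ)`** (Def. 4.11, ll. 2084–2090): a REAL conjugate symplectic character `μ` of
`C_E = E^× \ 𝔸_E^×` («a conjugate symplectic automorphic character (Definition 4.1) … whose value is necessarily in `ℂ^1`»),
a collection `ε` (⟨CARRIER⟩ `P.Eps`) and a character `χ` (⟨CARRIER⟩ `P.Chi`). [cite: Liu2021, Def. 4.11 (ll. 2084–2090)] -/
structure Triple : Type where
  /-- «`μ = ⊗ μ_v : E^× \ 𝔸_E^× → ℂ^×`» (l. 2086), REAL. -/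
  μ : IdeleClassGroup E →ₜ* Circle
  /-- «conjugate symplectic» (l. 2086; Def. 4.1 l. 1901), the tree's `IdeleClassGroup.IsConjugateSymplectic` over `E⁺ ≃ F`. -/
  isConjugateSymplectic : letI : IsCMField E := isCMField F E; IdeleClassGroup.IsConjugateSymplectic E μ
  /-- the collection `ε` (l. 2088), an element of the carrier `P.Eps`. -/
  ε : P.Eps
  /-- the character `χ` (l. 2090), an element of the carrier `P.Chi`. -/
  χ : P.Chi

variable {P}

/-- `Φ_μ`, «the CM type of `μ`» (Def. 4.3 (2), l. 1919) of the triple's `μ` (the weights of a conjugate symplectic character are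
odd, Remark 4.2, so `Φ_μ` is defined): the tree's `IsConjugateSymplectic.cmType`, as `Thm418Data.cmType`.
[cite: Liu2021, Def. 4.3 (2)] -/
def Triple.cmType (t : P.Triple) : CMType E :=
  letI : IsCMField E := isCMField F E
  t.isConjugateSymplectic.cmType

/-- «`μ` is of weight one» (Def. 4.3 (1), l. 1917; the index condition of Prop. 4.13, l. 2118): the tree's
`IdeleClassGroup.HasWeight E μ 1`, as `Thm418Data.hasWeight_one`. [cite: Liu2021, Def. 4.3 (1) and Prop. 4.13] -/
def Triple.HasWeightOne (t : P.Triple) : Prop :=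
  letI : IsCMField E := isCMField F E
  IdeleClassGroup.HasWeight E t.μ 1

/-- **«`ε` is `μ`-admissible»** (Def. 4.12, ll. 2102–2108): «there exists some `e ∈ E^{×−}` such that • `ε_v = e Nm_{E_v/F_v} E_v^×`
for every nonarchimedean place `v` of `F`, and • `τ'(e)` has negative imaginary part for every `τ' ∈ Φ_μ`» — the element `e`
through the tree's `IsAdmissibleElement E Φ_μ e` (`e ≠ 0`, `\bar e = −e`, `Im τ'(e) < 0` for `τ' ∈ Φ_μ`), the collection through
the carrier `epsOf`; token for token `Thm418Data.IsAdmissible` at the triple's own `μ`. [cite: Liu2021, Def. 4.12] -/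
def Triple.IsAdmissible (t : P.Triple) : Prop :=
  letI : IsCMField E := isCMField F E
  ∃ e : E, IsAdmissibleElement E t.cmType.1 e ∧ P.epsOf e = t.ε

variable (P)

/-- The index of the direct sum of Prop. 4.13: «all adèlic oscillator triples in which `μ` is of weight one and `ε` is
`μ`-admissible» (l. 2118). [cite: Liu2021, Prop. 4.13] -/
def AdmTriple : Type :=
  {t : P.Triple // t.HasWeightOne ∧ t.IsAdmissible}

/-- `ω_t = ω(μ, ε, χ)` for an admissible triple `t = (μ, ε, χ)`. [cite: Liu2021, Def. 4.11 and Prop. 4.13] -/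
abbrev omegaAt (t : P.AdmTriple) : Type :=
  P.omega t.1.μ t.1.isConjugateSymplectic t.1.ε t.1.χ

/-- The action of `g ∈ 𝔾(𝔸_F^∞)` on `ω_t`. [cite: Liu2021, Def. 4.11] -/
abbrev rhoAt (t : P.AdmTriple) : Representation ℂ P.G (P.omegaAt t) :=
  P.rho t.1.μ t.1.isConjugateSymplectic t.1.ε t.1.χ

end Prop413Data

/-! ## Proposition 4.13, exactly as printed -/

/-- **[Liu2021, Proposition 4.13] EXACTLY AS PRINTED** (`FJcycle.tex` ll. 2113–2119, TeX label `pr:endoscopy_general`), for the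
datum `P` (standing hypotheses l. 1878: `F` totally real, `E/F` totally imaginary quadratic — the instance arguments; l. 2053:
`n ≥ 2`, `𝕍`/`𝔾(𝔸_F^∞)`; the carriers of `Prop413Data`):

«Suppose that `n ≥ 3`. Then for every embedding `τ' : E → ℂ`, there is an isomorphism `H¹_{B,τ'}(A_∞, ℂ) ≃ ⊕_{(μ,ε,χ)} ω(μ, ε, χ)`
of `ℂ[𝔾(𝔸_F^∞)]`-modules, where the direct sum is taken over all adèlic oscillator triples in which `μ` is of weight one and `ε`
is `μ`-admissible.»

TYPED: `3 ≤ n →` for every `τ' : E →+* ℂ` there EXISTS a `ℂ`-linear equivalence `Φ : H¹_{B,τ'}(A_∞, ℂ) ≃ₗ[ℂ] ⨁_{t} ω_t`, `t` over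
`AdmTriple P` (REAL weight-one and `μ`-admissibility conditions on the REAL characters `μ`), intertwining the action of every
`g ∈ 𝔾(𝔸_F^∞)` on `H¹_{B,τ'}(A_∞, ℂ)` with its componentwise action on the sum (READING R6 of `Thm418AsPrinted`: a
`ℂ[G]`-module isomorphism = a `ℂ`-linear equivalence that is `G`-equivariant).  No hypothesis added, none dropped (no condition on
`τ'`, on `[F:ℚ]`, no Galois / signature / compactness condition; `n ≥ 3` as printed).  A consumer takes `(h : Prop413AsPrinted P)`
for ITS OWN `P` (e.g. with `P.HB τ'` its constructed tower colimit of `H¹(P_Γ(V); ℂ)`); `∀ P, Prop413AsPrinted P` is not the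
proposition and is not claimed.  NO PROOF (Track 2). [cite: Liu2021, Prop. 4.13] -/
def Prop413AsPrinted {F E : Type} [Field F] [NumberField F] [IsTotallyReal F] [Field E] [NumberField E] [Algebra F E]
    [IsTotallyComplex E] [Algebra.IsQuadraticExtension F E] (P : Prop413Data F E) : Prop :=
  3 ≤ P.n → ∀ τ' : E →+* ℂ,
    ∃ Φ : P.HB τ' ≃ₗ[ℂ] (⨁ t : P.AdmTriple, P.omegaAt t),
      -- «isomorphism … of ℂ[𝔾(𝔸_F^∞)]-modules» (l. 2114–2118)
      ∀ (g : P.G) (x : P.HB τ') (t : P.AdmTriple), Φ (P.rhoB τ' g x) t = P.rhoAt t g (Φ x t)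

namespace Prop413Data

variable {F E : Type} [Field F] [NumberField F] [IsTotallyReal F] [Field E] [NumberField E] [Algebra F E]
  [IsTotallyComplex E] [Algebra.IsQuadraticExtension F E] {P : Prop413Data F E}

/-- Dot-notation alias: `P.Prop413AsPrinted`. [cite: Liu2021, Prop. 4.13] -/
protected abbrev Prop413AsPrinted (P : Prop413Data F E) : Prop := Liu2021.Prop413AsPrinted P

/-- Unfolding of the index condition: `t` is an admissible index iff `μ_t` has weight one and `ε_t` is `μ_t`-admissible.
[cite: Liu2021, Prop. 4.13] -/
theorem mem_admTriple_iff (t : P.Triple) :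
    (∃ s : P.AdmTriple, s.1 = t) ↔ t.HasWeightOne ∧ t.IsAdmissible :=
  ⟨fun ⟨s, hs⟩ => hs ▸ s.2, fun h => ⟨⟨t, h⟩, rfl⟩⟩

/-- Bookkeeping consequence: under Prop. 4.13 (and `n ≥ 3`), for each `τ'` every admissible summand `ω_t` EMBEDS
`G`-equivariantly into `H¹_{B,τ'}(A_∞, ℂ)` (compose the inclusion of the `t`-th summand with `Φ⁻¹`) — the «placement» direction
the cells' package reading uses. [cite: Liu2021, Prop. 4.13] -/
theorem exists_equivariant_injective_of_asPrinted (h : Liu2021.Prop413AsPrinted P) (hn : 3 ≤ P.n) (τ' : E →+* ℂ)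
    (t : P.AdmTriple) :
    ∃ j : P.omegaAt t →ₗ[ℂ] P.HB τ', Function.Injective j ∧
      ∀ (g : P.G) (v : P.omegaAt t), j (P.rhoAt t g v) = P.rhoB τ' g (j v) := by
  classical
  obtain ⟨Φ, hΦ⟩ := h hn τ'
  refine ⟨Φ.symm.toLinearMap ∘ₗ DirectSum.lof ℂ P.AdmTriple P.omegaAt t, fun a b hab => ?_, fun g v => ?_⟩
  · simp only [LinearMap.coe_comp, LinearEquiv.coe_coe, Function.comp_apply] at hab
    exact DirectSum.of_injective (β := fun s => P.omegaAt s) t (Φ.symm.injective hab)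
  apply Φ.injective
  simp only [LinearMap.coe_comp, LinearEquiv.coe_coe, Function.comp_apply, LinearEquiv.apply_symm_apply]
  refine DFinsupp.ext fun s => ?_
  rw [hΦ g (Φ.symm (DirectSum.lof ℂ P.AdmTriple P.omegaAt t v)) s, LinearEquiv.apply_symm_apply]
  by_cases hst : s = t
  · subst hst
    simp only [DirectSum.lof_eq_of, DirectSum.of_eq_same]
  · have h1 : (DirectSum.lof ℂ P.AdmTriple P.omegaAt t v) s = 0 := by
      rw [DirectSum.lof_eq_of, DirectSum.of_eq_of_ne _ _ _ hst]
    have h2 : (DirectSum.lof ℂ P.AdmTriple P.omegaAt t (P.rhoAt t g v)) s = 0 := by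
      rw [DirectSum.lof_eq_of, DirectSum.of_eq_of_ne _ _ _ hst]
    rw [h1, h2, map_zero]

/-! ### Bridge to `Thm418Data`: Thm. 4.18's datum at one weight-one `μ` over the SAME carriers -/

/-- **The data of Thm. 4.18 beyond those of Prop. 4.13**, for ONE conjugate symplectic `μ` of weight one over the datum `P`
(Def. 4.16, l. 2219: «Let `μ` … be a conjugate symplectic character of weight one»): the ⟨CARRIER⟩s `Obj` (the objects of `𝒜(μ)`,
Def. 4.5), `Ω(μ)` with its `M_μ[𝔾(𝔸_F^∞)]`-structure (Def. 4.16), `Hom_E(A_K, A_μ)_ℚ` and the canonical maps (l. 2239, Rem. 4.17) —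
VERBATIM the corresponding fields of `Thm418Data`, so that a consumer citing BOTH Prop. 4.13 and Thm. 4.18 for the same `𝕍` does so
over literally the same `G`, `Eps`, `Chi` and the same modules `ω(μ, ε, χ) = P.omega μ _ ε χ` (`toThm418Data`).  Nothing asserted.
[cite: Liu2021, Def. 4.5, Def. 4.16, Rem. 4.17, Thm. 4.18] -/
structure Rest418 (P : Prop413Data F E) (μ : IdeleClassGroup E →ₜ* Circle) : Type 1 where
  /-- «conjugate symplectic» (Def. 4.16 l. 2219; Def. 4.1). -/
  isConjugateSymplectic : letI : IsCMField E := isCMField F E; IdeleClassGroup.IsConjugateSymplectic E μ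
  /-- «of weight one» (Def. 4.16 l. 2219; Def. 4.3 (1)). -/
  hasWeight_one : letI : IsCMField E := isCMField F E; IdeleClassGroup.HasWeight E μ 1
  /-- ⟨CARRIER⟩ as `Thm418Data.Obj` (Def. 4.5 (2)–(3)). -/
  Obj : Type
  /-- ⟨CARRIER⟩ as `Thm418Data.Ω` (Def. 4.16). -/
  Ω : Type
  [instAddCommGroupΩ : AddCommGroup Ω]
  [instModuleΩ : Module (fieldOfValues E μ) Ω]
  /-- ⟨CARRIER⟩ as `Thm418Data.rhoΩ` (l. 2219 with l. 2074). -/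
  rhoΩ : Representation (fieldOfValues E μ) P.G Ω
  /-- ⟨CARRIER⟩ as `Thm418Data.HomK` (l. 2239). -/
  HomK : Subgroup P.G → Obj → Type
  [instAddCommGroupHomK : ∀ K D, AddCommGroup (HomK K D)]
  /-- ⟨CARRIER⟩ as `Thm418Data.res` (l. 2070–2072, Rem. 4.17). -/
  res : ∀ K D, HomK K D →+ Ω

/-- **Thm. 4.18's datum at `μ` over the carriers of `P`**: rank, `𝕍`, `G = 𝔾(𝔸_F^∞)`, `Eps`, `epsOf`, `Chi` are `P`'s, the
`ω(μ, ε, χ)` are `P.omega μ _ ε χ` with their `G`-actions, and the rest is `R`'s. [cite: Liu2021, Prop. 4.13 and Thm. 4.18] -/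
def toThm418Data (P : Prop413Data F E) {μ : IdeleClassGroup E →ₜ* Circle} (R : P.Rest418 μ) : Thm418Data F E where
  n := P.n
  two_le_n := P.two_le_n
  𝕍 := P.𝕍
  G := P.G
  Eps := P.Eps
  epsOf := P.epsOf
  Chi := P.Chi
  μ := μ
  isConjugateSymplectic := R.isConjugateSymplectic
  hasWeight_one := R.hasWeight_one
  Obj := R.Obj
  omega := P.omega μ R.isConjugateSymplectic
  instAddCommGroupOmega := fun ε χ => P.instAddCommGroupOmega μ R.isConjugateSymplectic ε χ
  instModuleOmega := fun ε χ => P.instModuleOmega μ R.isConjugateSymplectic ε χ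
  rho := P.rho μ R.isConjugateSymplectic
  Ω := R.Ω
  instAddCommGroupΩ := R.instAddCommGroupΩ
  instModuleΩ := R.instModuleΩ
  rhoΩ := R.rhoΩ
  HomK := R.HomK
  instAddCommGroupHomK := R.instAddCommGroupHomK
  res := R.res

/-- An index `(ε, χ)` of Thm. 4.18's sum at `μ` IS an index `(μ, ε, χ)` of Prop. 4.13's sum (same admissibility clause, Def. 4.12,
plus `μ` of weight one). [cite: Liu2021, Prop. 4.13 and Thm. 4.18] -/
def admTripleOf (P : Prop413Data F E) {μ : IdeleClassGroup E →ₜ* Circle} (R : P.Rest418 μ)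
    (i : (P.toThm418Data R).AdmIndex) : P.AdmTriple :=
  ⟨⟨μ, R.isConjugateSymplectic, i.1.1, i.1.2⟩, R.hasWeight_one, i.2⟩

/-- … and the summands agree on the nose: `ω_{(ε,χ)}` of Thm. 4.18 at `μ` is `ω_{(μ,ε,χ)}` of Prop. 4.13 (definitionally).
[cite: Liu2021, Prop. 4.13 and Thm. 4.18] -/
theorem omegaAt_toThm418Data (P : Prop413Data F E) {μ : IdeleClassGroup E →ₜ* Circle} (R : P.Rest418 μ)
    (i : (P.toThm418Data R).AdmIndex) : (P.toThm418Data R).omegaAt i = P.omegaAt (P.admTripleOf R i) := rfl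

/-- `admTripleOf` is injective (distinct `(ε, χ)` give distinct triples). [cite: Liu2021, Prop. 4.13 and Thm. 4.18] -/
theorem admTripleOf_injective (P : Prop413Data F E) {μ : IdeleClassGroup E →ₜ* Circle} (R : P.Rest418 μ) :
    Function.Injective (P.admTripleOf R) := fun i j h => by
  have h1 := congrArg (fun t : P.AdmTriple => (t.1.ε, t.1.χ)) h
  exact Subtype.ext (Prod.ext (congrArg Prod.fst h1) (congrArg Prod.snd h1))

/-- **The binder list is inhabited** (hypothesis non-vacuity, not a statement about Liu's objects): the carriers can be
instantiated trivially (`G := PUnit`, zero modules, `n := 2`), so `Prop413Data F E` is non-empty over every CM extension as in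
l. 1878; and at `n := 2` the proposition holds vacuously — a consumer's `P` has its own `n`.  Our bookkeeping.
[cite: Liu2021, §4.2 l. 2053] -/
theorem nonempty (F E : Type) [Field F] [NumberField F] [IsTotallyReal F] [Field E] [NumberField E] [Algebra F E]
    [IsTotallyComplex E] [Algebra.IsQuadraticExtension F E] : Nonempty (Prop413Data F E) :=
  ⟨⟨2, le_rfl, PUnit, PUnit, PUnit, fun _ => PUnit.unit, PUnit, fun _ _ _ _ => PUnit, fun _ _ _ _ => 1, fun _ => PUnit, fun _ => 1⟩⟩

end Prop413Data

end Literature.NumberTheory.Automorphic.Liu2021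

end
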